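import Summits.ResolutionOfSingularities.ResolutionOfSingularities.Theorems.RadicialJungCleanModelsLens5KbarReadOff1
import HarnessLib

/-!
# Route `RadicialJung`, crux `CleanModels` (stmt-15917) — lens 5, the `k = k̄` anchor of stub :249, part 2/5:
# LEMMA G IN KERNEL — the read-off of Cossart's `ν = 0` along a `p`-basis (`readOff_core`)

Port (res-B-lead-1 g6) of §9 C of the crux workfile `Cruxes/DescentPerfectToAll/Lens5_KbarCossartAnchor.lean` rev 12 (author:
res-B-lens-5 g11; standalone copy `Lens5_KbarReadOff.lean` f4658622e3d840a0), statement and proof verbatim, namespace renamed.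
OURS · counted 0.  Nothing here proves resolution in characteristic `p`; resolution in char `p` is NOT proved.

MAIN THEOREM `readOff_core` (pure commutative algebra, characteristic `p`): `O` regular local of characteristic `p`, `K = Frac O`,
`Γ ⊇ {t₁,…,t_d}` a `p`-basis of `O` over `O^p` (`𝔪 = (t)`, `d = dim O`), `x = (t₁,…,t_e)`, `f ∈ O`; if the logarithmic Jacobian
ideal `𝒥 = (D f : D ∈ Der(O), xᵢ ∣ D xᵢ)` equals the monomial ideal `(∏ xᵢ^{bᵢ})` (Cossart's `ν = 0` at the point), then for
suitable `c₀, c₁ ∈ K`, `c₁ ≠ 0`, the element `c₀^p + c₁^p f` is in one of Cossart–Piltant's clean forms (1) `u ∏ t′ⱼ^{aⱼ}`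
(`u` unit, `p ∤ aⱼ`, `t′` a regular system), (2) a unit that is not a `p`-th power mod `𝔪`, (3) `s ≡ c^p (mod 𝔪)`, `s - c^p ∉ 𝔪²`.
Proof (lens-5 memo `KBAR-anchor-Cossart87-lens5-g11.md` §4 (i)–(iv)): no cancellation between monomial classes (✓
`term_mem_of_mul_derivation_sum_mem`) ⇒ `f - F^p = M g`; factorisation `𝒥 ⊆ M · J′` and domain cancellation ⇒ `J′ = (1)`;
case analysis with the EXCHANGE lemma `span_range_update_eq` and the REORDERING lemma `exists_reorder` (part 1).
-/

noncomputable section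

set_option linter.dupNamespace false

open IsLocalRing Literature.RingTheory.PBasis Literature.AlgebraicGeometry.Resolution
open Summit.ResolutionOfSingularities.ResolutionOfSingularities.Theorems.RadicialJung.CleanModels

namespace Summit.ResolutionOfSingularities.ResolutionOfSingularities.Theorems.RadicialJung.CleanModels.Lens5.KbarCossart.ReadOff

/-! ### C. The read-off theorem (G-alg) -/

section Main

variable {p : ℕ} [hp : Fact p.Prime] {O : Type} [CommRing O] [IsRegularLocalRing O] [CharP O p]
  {K : Type} [Field K] [Algebra O K] [IsFractionRing O K]

/-- **(G-alg), core form.** Ring-level read-off (lens-5 anchor §8 `NuZeroReadOffOfPBasis`): for a regular local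
ring `O` of characteristic `p` with a `p`-basis `Γ ⊇ {t₁,…,t_d}` (`𝔪 = (t)`, `d = dim O`), an element `f ∉ K^p`
whose logarithmic Jacobian ideal along `x = (t₁,…,t_e)` is the monomial ideal `(∏ xᵢ^{bᵢ})` admits, after the
correction `c₀^p + c₁^p f`, one of Cossart–Piltant's three clean forms (1) / (2) / (3) (memo §4 (i)–(iv); engine: Giraud 1983,
2.6 (6) = ✓ `term_mem_of_mul_derivation_sum_mem`).  The hypothesis `f ∉ K^p` is not even used (it follows from `hJ`). [folklore] -/
theorem readOff_core {Γ : Set O} (hΓ : IsPBasisOver p (frobenius O p).range Γ) {d e : ℕ} (hed : e ≤ d)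
    (t : Fin d → O) (x : Fin e → O) (hxt : ∀ i, t (Fin.castLE hed i) = x i) (b : Fin e → ℕ)
    (ht : Ideal.span (Set.range t) = maximalIdeal O) (hd : ringKrullDim O = (d : WithBot ℕ∞))
    (htΓ : Set.range t ⊆ Γ) (f : O) (_hf : ∀ c : K, c ^ p ≠ algebraMap O K f)
    (hJ : Ideal.span {v : O | ∃ D : Derivation ℤ O O, (∀ i : Fin e, x i ∣ D (x i)) ∧ D f = v} =
      Ideal.span {∏ i : Fin e, x i ^ b i}) :
    ∃ c₀ c₁ : K, c₁ ≠ 0 ∧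
    ((∃ (d' m : ℕ) (hmd : m ≤ d') (t' : Fin d' → O) (a' : Fin m → ℕ) (w : O), IsUnit w ∧
        Ideal.span (Set.range t') = maximalIdeal O ∧ ringKrullDim O = (d' : WithBot ℕ∞) ∧ 0 < m ∧
        (∀ i, ¬ p ∣ a' i) ∧
        c₀ ^ p + c₁ ^ p * algebraMap O K f = algebraMap O K (w * ∏ i : Fin m, t' (Fin.castLE hmd i) ^ (a' i))) ∨
     (∃ w : O, IsUnit w ∧ c₀ ^ p + c₁ ^ p * algebraMap O K f = algebraMap O K w ∧
        ∀ c : O, w - c ^ p ∉ maximalIdeal O) ∨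
     (∃ s c : O, c₀ ^ p + c₁ ^ p * algebraMap O K f = algebraMap O K s ∧ s - c ^ p ∈ maximalIdeal O ∧
        s - c ^ p ∉ maximalIdeal O ^ 2)) := by
  classical
  have hp' : p.Prime := hp.out
  haveI : IsDomain O := isDomain_of_isRegularLocalRing O
  haveI : CharP K p := charP_of_injective_algebraMap (IsFractionRing.injective O K) p
  -- the parameters `x`
  have htinj : Function.Injective t := rsop_injective hd ht
  have hxinj : Function.Injective x := by
    intro i j h
    rw [← hxt, ← hxt] at h
    exact Fin.castLE_injective hed (htinj h)
  have hxΓ : ∀ i, x i ∈ Γ := fun i => hxt i ▸ htΓ ⟨_, rfl⟩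
  have hx𝔪 : ∀ i, x i ∈ maximalIdeal O := fun i => by
    rw [← hxt, ← ht]; exact Ideal.subset_span ⟨_, rfl⟩
  have hxne : ∀ i, x i ≠ 0 := fun i => hxt i ▸ rsop_ne_zero hd ht _
  let γx : Fin e → Γ := fun i => ⟨x i, hxΓ i⟩
  have hγxinj : Function.Injective γx := fun i j h => hxinj (congrArg Subtype.val h)
  have hγx_coe : ∀ i, ((γx i : Γ) : O) = x i := fun i => rfl
  obtain ⟨δ, hδ₁, hδ₀⟩ := IsPBasisOver.exists_dual_derivations hΓ
  -- the monomial `M = ∏ xᵢ^{bᵢ}` and the ideal `I = (M)`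
  set M : O := ∏ i, x i ^ b i with hMdef
  have hMne : M ≠ 0 := Finset.prod_ne_zero_iff.mpr fun i _ => pow_ne_zero _ (hxne i)
  set I : Ideal O := Ideal.span {M} with hIdef
  -- (A) the diagonal operators `γ δ_γ` are logarithmic along `x` and stabilise `I`
  have hdiag_log : ∀ γ : Γ, ∀ i, ((γ : O) • δ γ) (x i) = x i * (if γx i = γ then 1 else 0) := by
    intro γ i
    rw [Derivation.smul_apply, smul_eq_mul]
    split_ifs with h
    · rw [← h, hγx_coe, hδ₁, mul_one]
    · rw [← hγx_coe i, hδ₀ γ (γx i) h, mul_zero, mul_zero]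
  have hdiagM : ∀ γ : Γ, (γ : O) * δ γ M = M * ∑ i, (b i : O) * (if γx i = γ then 1 else 0) := by
    intro γ
    have := derivation_prod_pow_of_log Finset.univ ((γ : O) • δ γ) x (fun i => if γx i = γ then 1 else 0) b
      (fun i _ => hdiag_log γ i)
    rwa [Derivation.smul_apply, smul_eq_mul] at this
  have hIst : ∀ γ : Γ, ∀ v ∈ I, (γ : O) * δ γ v ∈ I := by
    intro γ v hv
    obtain ⟨a, rfl⟩ := Ideal.mem_span_singleton'.mp hv
    have : (γ : O) * δ γ (a * M) =
        (a * ∑ i, (b i : O) * (if γx i = γ then 1 else 0) + (γ : O) * δ γ a) * M := by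
      rw [(δ γ).leibniz, smul_eq_mul, smul_eq_mul, mul_add, ← mul_assoc, mul_comm (γ : O) a, mul_assoc,
        hdiagM γ]
      ring
    rw [this]
    exact Ideal.mul_mem_left _ _ (Ideal.mem_span_singleton_self M)
  -- (B) expansion of `f` along the `p`-basis; the terms of nonzero class lie in `I`
  obtain ⟨c, hc⟩ := IsPBasisOver.exists_monomial_expansion hΓ f
  have hsum : (∑ β ∈ c.support, (c β : O) * (β.1).prod (fun γ n => ((γ : Γ) : O) ^ n)) = f := hc
  have hL : ∀ D : Derivation ℤ O O, (∀ i, x i ∣ D (x i)) → D f ∈ I := by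
    intro D hD
    have hmem : D f ∈ Ideal.span {v : O | ∃ D : Derivation ℤ O O, (∀ i : Fin e, x i ∣ D (x i)) ∧ D f = v} :=
      Ideal.subset_span ⟨D, hD, rfl⟩
    rwa [hJ] at hmem
  have hTf : ∀ γ : Γ, (γ : O) * δ γ f ∈ I := by
    intro γ
    have := hL ((γ : O) • δ γ) (fun i => ⟨_, hdiag_log γ i⟩)
    rwa [Derivation.smul_apply, smul_eq_mul] at this
  have hterm : ∀ β ∈ c.support, β.1 ≠ 0 →
      (c β : O) * (β.1).prod (fun γ n => ((γ : Γ) : O) ^ n) ∈ I := by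
    intro β hβ hβ0
    obtain ⟨γ, hγ⟩ : ∃ γ, β.1 γ ≠ 0 := by
      by_contra h
      push Not at h
      exact hβ0 (Finsupp.ext h)
    refine term_mem_of_mul_derivation_sum_mem δ hδ₁ hδ₀ I hIst γ c.support (fun β => c β) ?_ β hβ hγ
    rw [hsum]
    exact hTf γ
  -- (C) `f - F^p ∈ I`
  let β0 : {b : Γ →₀ ℕ // ∀ γ, b γ < p} := ⟨0, fun _ => hp'.pos⟩
  obtain ⟨F, hF⟩ : ∃ F : O, (c β0 : O) = F ^ p := by
    obtain ⟨F, hF⟩ := RingHom.mem_range.mp (c β0).2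
    exact ⟨F, by rw [← hF, frobenius_def]⟩
  have hfF : f - F ^ p ∈ I := by
    rw [← hF]
    by_cases h0 : β0 ∈ c.support
    · rw [← hsum, ← Finset.add_sum_erase _ _ h0]
      have hmono0 : (β0.1).prod (fun γ n => ((γ : Γ) : O) ^ n) = 1 := Finsupp.prod_zero_index
      rw [hmono0, mul_one, add_sub_cancel_left]
      exact Ideal.sum_mem _ fun β hβ =>
        hterm β (Finset.mem_of_mem_erase hβ) (fun h => Finset.ne_of_mem_erase hβ (Subtype.ext h))
    · have hc0 : (c β0 : O) = 0 := by rw [Finsupp.notMem_support_iff.mp h0]; rfl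
      rw [hc0, sub_zero, ← hsum]
      refine Ideal.sum_mem _ fun β hβ => hterm β hβ (fun h => h0 ?_)
      have : β = β0 := Subtype.ext h
      rwa [this] at hβ
  obtain ⟨g, hg⟩ := Ideal.mem_span_singleton'.mp hfF
  have hfeq : f = F ^ p + g * M := sub_eq_iff_eq_add'.mp hg.symm
  -- (D) the ideal `J'` and the factorisation `𝒥 ⊆ (M) · J'`
  let gen : Fin e → O := fun i => (b i : O) * g + x i * δ (γx i) g
  let N : Set O := {v | ∃ γ : Γ, (∀ i, γx i ≠ γ) ∧ δ γ g = v}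
  let J' : Ideal O := Ideal.span (Set.range gen ∪ N)
  have hxδM : ∀ i, x i * δ (γx i) M = M * (b i : O) := by
    intro i
    rw [← hγx_coe i, hdiagM (γx i)]
    congr 1
    simp_rw [hγxinj.eq_iff, mul_boole]
    rw [Finset.sum_ite_eq']
    simp
  have hxδf : ∀ i, x i * δ (γx i) f = M * gen i := by
    intro i
    rw [hfeq, map_add, derivation_pow_char (p := p), zero_add, (δ (γx i)).leibniz, smul_eq_mul, smul_eq_mul,
      mul_add, ← mul_assoc, mul_comm (x i) g, mul_assoc, hxδM i]
    simp only [gen]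
    ring
  have hfact : ∀ D : Derivation ℤ O O, (∀ i, x i ∣ D (x i)) → D f ∈ I * J' := by
    intro D hD
    choose w hw using hD
    let D' : Derivation ℤ O O := D - ∑ i, (w i * x i) • δ (γx i)
    have hD'apply : ∀ r, D' r = D r - ∑ i, (w i * x i) * δ (γx i) r := by
      intro r
      simp only [D', Derivation.sub_apply, sum_smul_derivation_apply']
    have hD'x : ∀ j, D' (x j) = 0 := by
      intro j
      rw [hD'apply, hw j, Finset.sum_eq_single j (fun i _ hij => by
          rw [← hγx_coe j, hδ₀ (γx i) (γx j) (fun h => hij (hγxinj h).symm), mul_zero])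
        (fun hn => (hn (Finset.mem_univ _)).elim), ← hγx_coe j, hδ₁, mul_one, hγx_coe, mul_comm, sub_self]
    have hD'M : D' M = 0 := derivation_prod_pow_eq_zero D' x b Finset.univ (fun i _ => hD'x i)
    have hD'F : D' (F ^ p) = 0 := derivation_pow_char (p := p) D' F
    have hDf : D f = ∑ i, (w i * x i) * δ (γx i) f + D' f := by
      rw [hD'apply]; ring
    have hD'f : D' f = M * D' g := by
      rw [hfeq, map_add, hD'F, zero_add, D'.leibniz, hD'M, smul_eq_mul, smul_eq_mul, mul_zero, zero_add]
    have hD'g : D' g ∈ Ideal.span N := by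
      obtain ⟨Fg, hFg⟩ := derivation_apply_eq_sum_mul_dual δ hδ₁ hδ₀ hΓ g
      rw [hFg D']
      refine Ideal.sum_mem _ fun γ _ => ?_
      by_cases h : ∃ i, γx i = γ
      · obtain ⟨i, rfl⟩ := h
        rw [hγx_coe, hD'x i, zero_mul]
        exact Ideal.zero_mem _
      · push Not at h
        exact Ideal.mul_mem_left _ _ (Ideal.subset_span ⟨γ, h, rfl⟩)
    rw [hDf]
    refine Ideal.add_mem _ (Ideal.sum_mem _ fun i _ => ?_) ?_
    · rw [mul_assoc, hxδf i, ← mul_assoc, mul_comm (w i) M, mul_assoc]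
      exact Ideal.mul_mem_mul (Ideal.mem_span_singleton_self M)
        (Ideal.mul_mem_left _ _ (Ideal.subset_span (Or.inl ⟨i, rfl⟩)))
    · rw [hD'f]
      exact Ideal.mul_mem_mul (Ideal.mem_span_singleton_self M) (Ideal.span_mono Set.subset_union_right hD'g)
  -- hence `J' = ⊤`
  have hJ'top : J' = ⊤ := by
    have hMmem : M ∈ I * J' := by
      have hM : M ∈ Ideal.span {v : O | ∃ D : Derivation ℤ O O, (∀ i : Fin e, x i ∣ D (x i)) ∧ D f = v} := by
        rw [hJ]; exact Ideal.mem_span_singleton_self M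
      have hle : Ideal.span {v : O | ∃ D : Derivation ℤ O O, (∀ i : Fin e, x i ∣ D (x i)) ∧ D f = v} ≤ I * J' :=
        Ideal.span_le.mpr (by rintro _ ⟨D, hD, rfl⟩; exact hfact D hD)
      exact hle hM
    obtain ⟨z, hz, hMz⟩ := Ideal.mem_span_singleton_mul.mp hMmem
    have hz1 : z = 1 := mul_left_cancel₀ hMne (by rw [hMz, mul_one])
    rw [hz1] at hz
    exact (Ideal.eq_top_iff_one _).mpr hz
  -- some generator is a unit
  have hunit : (∃ i, IsUnit (gen i)) ∨ ∃ γ : Γ, (∀ i, γx i ≠ γ) ∧ IsUnit (δ γ g) := by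
    by_contra hcon
    push Not at hcon
    have hle : J' ≤ maximalIdeal O := by
      refine Ideal.span_le.mpr ?_
      rintro v (⟨i, rfl⟩ | ⟨γ, hγ, rfl⟩)
      · exact (IsLocalRing.mem_maximalIdeal _).mpr (hcon.1 i)
      · exact (IsLocalRing.mem_maximalIdeal _).mpr (hcon.2 γ hγ)
    rw [hJ'top, top_le_iff] at hle
    exact (IsLocalRing.maximalIdeal.isMaximal O).ne_top hle
  -- arithmetic in `K`: `c₁ = (∏ xᵢ^{⌊bᵢ/p⌋})⁻¹`, `c₀ = -c₁ F`
  let r : Fin e → ℕ := fun i => b i % p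
  let Q : O := ∏ i, x i ^ (b i / p)
  have hQne : Q ≠ 0 := Finset.prod_ne_zero_iff.mpr fun i _ => pow_ne_zero _ (hxne i)
  have hQK : algebraMap O K Q ≠ 0 := fun h =>
    hQne (IsFractionRing.injective O K (by rw [h, map_zero]))
  let c₁ : K := (algebraMap O K Q)⁻¹
  let c₀ : K := -(c₁ * algebraMap O K F)
  have hc₁ : c₁ ≠ 0 := inv_ne_zero hQK
  have hMQ : M = Q ^ p * ∏ i, x i ^ r i := by
    simp only [hMdef, Q, r]
    rw [← Finset.prod_pow, ← Finset.prod_mul_distrib]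
    refine Finset.prod_congr rfl fun i _ => ?_
    rw [← pow_mul, ← pow_add, Nat.div_add_mod']
  have hkey : c₀ ^ p + c₁ ^ p * algebraMap O K f = algebraMap O K (g * ∏ i, x i ^ r i) := by
    have hcQ : c₁ * algebraMap O K Q = 1 := inv_mul_cancel₀ hQK
    have h1 : c₀ ^ p = -(c₁ ^ p * algebraMap O K F ^ p) := by
      simp only [c₀]
      rw [neg_pow, neg_one_pow_char K p, mul_pow]
      ring
    rw [h1, hfeq, hMQ]
    simp only [map_add, map_mul, map_pow]
    calc -(c₁ ^ p * algebraMap O K F ^ p) + c₁ ^ p * (algebraMap O K F ^ p +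
          algebraMap O K g * ((algebraMap O K Q) ^ p * algebraMap O K (∏ i, x i ^ r i)))
        = (c₁ * algebraMap O K Q) ^ p * (algebraMap O K g * algebraMap O K (∏ i, x i ^ r i)) := by ring
      _ = algebraMap O K g * algebraMap O K (∏ i, x i ^ r i) := by rw [hcQ, one_pow, one_mul]
  have hrp : ∀ i, r i ≠ 0 → ¬ p ∣ r i := fun i hi hdvd =>
    hi (Nat.eq_zero_of_dvd_of_lt hdvd (Nat.mod_lt _ hp'.pos))
  refine ⟨c₀, c₁, hc₁, ?_⟩
  -- (E) the cases
  by_cases hgu : IsUnit g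
  · by_cases hr : ∃ i, r i ≠ 0
    · -- form (1): `g · ∏ xᵢ^{rᵢ}`, reordered
      left
      obtain ⟨i₀, hi₀⟩ := hr
      let ρ : Fin d → ℕ := fun l => if h : (l : ℕ) < e then r ⟨l, h⟩ else 0
      have hρr : ∏ l, t l ^ ρ l = ∏ i, x i ^ r i := by
        rw [prod_pow_extend hed t r]
        simp_rw [hxt]
      have hρ0 : ∀ l, ρ l ≠ 0 → ¬ p ∣ ρ l := by
        intro l hl
        simp only [ρ] at hl ⊢
        split_ifs at hl ⊢ with h
        · exact hrp _ hl
        · exact (hl rfl).elim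
      obtain ⟨m, hmd, t', a', hrange, hmpos, ha', hprod⟩ := exists_reorder t ρ
      refine ⟨d, m, hmd, t', a', g, hgu, by rw [hrange, ht], hd, hmpos ⟨Fin.castLE hed i₀, ?_⟩, fun j => ?_, ?_⟩
      · simp only [ρ]
        rw [dif_pos (show ((Fin.castLE hed i₀ : Fin d) : ℕ) < e from i₀.2)]
        exact hi₀
      · obtain ⟨l, hl0, hl⟩ := ha' j
        rw [hl]; exact hρ0 l hl0
      · rw [hkey, ← hρr, hprod]
    · -- all `bᵢ ≡ 0 (mod p)`: forms (2)/(3)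
      push Not at hr
      have hprod1 : ∏ i, x i ^ r i = 1 := Finset.prod_eq_one fun i _ => by rw [hr i, pow_zero]
      rw [hprod1, mul_one] at hkey
      obtain ⟨i, hi⟩ | ⟨γ, hγ, hγu⟩ := hunit
      · exfalso
        have hbi : (b i : O) = 0 := (CharP.cast_eq_zero_iff O p (b i)).mpr (Nat.dvd_of_mod_eq_zero (hr i))
        have hmem : gen i ∈ maximalIdeal O := by
          show (b i : O) * g + x i * δ (γx i) g ∈ maximalIdeal O
          rw [hbi, zero_mul, zero_add]
          exact Ideal.mul_mem_right _ _ (hx𝔪 i)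
        exact ((IsLocalRing.mem_maximalIdeal _).mp hmem) hi
      · by_cases hres : ∀ c : O, g - c ^ p ∉ maximalIdeal O
        · exact Or.inr (Or.inl ⟨g, hgu, hkey, hres⟩)
        · push Not at hres
          obtain ⟨c', hc'⟩ := hres
          refine Or.inr (Or.inr ⟨g, c', hkey, hc', fun h2 => ?_⟩)
          have hD := derivation_apply_mem_of_mem_sq (maximalIdeal O) (δ γ) h2
          rw [map_sub, derivation_pow_char (p := p), sub_zero] at hD
          exact ((IsLocalRing.mem_maximalIdeal _).mp hD) hγu
  · -- `g ∈ 𝔪`: exchange a parameter for `g`, form (1)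
    have hg𝔪 : g ∈ maximalIdeal O := (IsLocalRing.mem_maximalIdeal _).mpr hgu
    obtain ⟨i, hi⟩ | ⟨γ, hγ, hγu⟩ := hunit
    · exfalso
      have hmem : gen i ∈ maximalIdeal O :=
        Ideal.add_mem _ (Ideal.mul_mem_left _ _ hg𝔪) (Ideal.mul_mem_right _ _ (hx𝔪 i))
      exact ((IsLocalRing.mem_maximalIdeal _).mp hmem) hi
    · -- `γ = t l` for some `l`
      have hγt : ∃ l, t l = (γ : O) := by
        by_contra hno
        push Not at hno
        have hkill : ∀ g' ∈ Set.range t, δ γ g' = 0 := by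
          rintro _ ⟨l, rfl⟩
          exact hδ₀ γ ⟨t l, htΓ ⟨l, rfl⟩⟩ (fun h => hno l (congrArg Subtype.val h))
        have hmem := derivation_apply_mem_span_of_forall_eq_zero (δ γ) hkill (v := g) (by rw [ht]; exact hg𝔪)
        rw [ht] at hmem
        exact ((IsLocalRing.mem_maximalIdeal _).mp hmem) hγu
      obtain ⟨l, hl⟩ := hγt
      have hlx : ∀ i, Fin.castLE hed i ≠ l := by
        intro i h
        apply hγ i
        apply Subtype.ext
        rw [hγx_coe, ← hxt, h, hl]
      let t₂ : Fin d → O := Function.update t l g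
      have ht₂ : Ideal.span (Set.range t₂) = maximalIdeal O :=
        span_range_update_eq t ht l g hg𝔪 (δ γ) (by rw [hl]; exact hδ₁ γ)
          (fun l' hl' => hδ₀ γ ⟨t l', htΓ ⟨l', rfl⟩⟩
            (fun h => hl' (htinj (by rw [hl]; exact congrArg Subtype.val h)))) hγu
      have ht₂x : ∀ i, t₂ (Fin.castLE hed i) = x i := fun i => by
        rw [← hxt]; exact Function.update_of_ne (hlx i) g t
      have ht₂l : t₂ l = g := Function.update_self l g t
      left
      let ρ : Fin d → ℕ := fun l' => if l' = l then 1 else (if h : (l' : ℕ) < e then r ⟨l', h⟩ else 0)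
      have hle : ¬ ((l : ℕ) < e) := fun h => hlx ⟨l, h⟩ (Fin.ext rfl)
      have hρr : ∏ l', t₂ l' ^ ρ l' = g * ∏ i, x i ^ r i := by
        rw [← Finset.mul_prod_erase Finset.univ _ (Finset.mem_univ l)]
        congr 1
        · simp only [ρ, if_pos rfl, pow_one, ht₂l]
        · have h1 : ∏ i, x i ^ r i = ∏ l', t₂ l' ^ (if h : (l' : ℕ) < e then r ⟨l', h⟩ else 0) := by
            rw [prod_pow_extend hed t₂ r]
            exact Finset.prod_congr rfl fun i _ => by rw [ht₂x]
          rw [h1, ← Finset.prod_erase (f := fun l' => t₂ l' ^ (if h : (l' : ℕ) < e then r ⟨l', h⟩ else 0))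
            Finset.univ (a := l) (by simp only [dif_neg hle, pow_zero])]
          refine Finset.prod_congr rfl fun l' hl' => ?_
          simp only [ρ, if_neg (Finset.ne_of_mem_erase hl')]
      have hρ0 : ∀ l', ρ l' ≠ 0 → ¬ p ∣ ρ l' := by
        intro l' hl'
        simp only [ρ] at hl' ⊢
        split_ifs at hl' ⊢ with h1 h2
        · exact hp'.not_dvd_one
        · exact hrp _ hl'
        · exact (hl' rfl).elim
      obtain ⟨m, hmd, t', a', hrange, hmpos, ha', hprod⟩ := exists_reorder t₂ ρ
      refine ⟨d, m, hmd, t', a', 1, isUnit_one, by rw [hrange, ht₂], hd, hmpos ⟨l, by simp [ρ]⟩, fun j => ?_, ?_⟩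
      · obtain ⟨l', hl0, hl'⟩ := ha' j
        rw [hl']; exact hρ0 l' hl0
      · rw [hkey, one_mul, ← hρr, hprod]

end Main

end Summit.ResolutionOfSingularities.ResolutionOfSingularities.Theorems.RadicialJung.CleanModels.Lens5.KbarCossart.ReadOff

end
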